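import Summits.AtomisticToContinuum.HydrodynamicLimit.Theorems.JaynesSqueezeSqueezeToBlockGibbsTimeZero
import Summits.AtomisticToContinuum.HydrodynamicLimit.Theorems.KineticWindowGronwall.Negative.ActivityDummy

/-!
# The squeeze `SqueezeToBlockGibbs` (route JaynesSqueeze), VIII: the fine-grained entropy of the initial law

Helper file (`--supports stmt-AtomisticToContinuum-13463`) for the support item `SqueezeToBlockGibbs` of route
`JaynesSqueeze`. Step (iii) of the item's plan: the time-zero term of the bookkeeping identity,
`E_λ⟨emp, log prof₀⟩ − (N+1)⁻¹ log Z_N(a₀)`, i.e. `(N+1)⁻¹ ∫ f₀ log f₀ dZ`, converges to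
`−𝒮[ρ_a, θ₀] − 3/2 − (3/2) log 2π`, where `𝒮[ρ, θ] = ∫ ρ (3/2 log θ − log ρ − f_ex(ρσ³))` is the hard-sphere
thermodynamic entropy and `ρ_a` is the static density profile of the data activity `a₀ = e^c ρ_a e^{g(ρ_a)}`
(`HardSphereLDA` (A)). Inputs, all hypotheses here: the local density approximation of the log-partition
function and the law of large numbers of the MEAN empirical density at the activity `ρ_a e^{g(ρ_a)}`
(`HardSphereLDA` (B)), the invariance of the canonical law under `a ↦ e^c a`
(`MacroClosureLine.StubLedger.localGibbsLaw_const_mul`) and the scaling `Z_N(e^c a) = e^{c(N+1)} Z_N(a)`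
(`canonicalPartition_const_mul`), and part III's equipartition identity (`integral_logPair_localGibbsLaw`).

References: Jaynes 1965; Ruelle 1969 §3.4; Spohn 1991 Part I §2.3.
-/

noncomputable section

open MeasureTheory Filter Set Topology
open scoped ENNReal

namespace Summit.AtomisticToContinuum.HydrodynamicLimit.Theorems.JaynesSqueezeSqueeze

open Literature.MathematicalPhysics.KineticTheory Literature.Analysis.FluidPDE
open Literature.Analysis.FunctionSpaces
open MacroClosureLine.StubLedger

/-- **Scaling of the canonical partition function in the activity**: `Z_n(c · prof) = c^n Z_n(prof)`. [folklore] -/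
theorem canonicalPartition_const_mul {n : ℕ} (c : ℝ) (ε : ℝ) (f : T3 × V3 → ℝ) :
    canonicalPartition (Torus.geometry (Fin 3)) ε n (fun y => c * f y) =
      c ^ n * canonicalPartition (Torus.geometry (Fin 3)) ε n f := by
  set D := hardSphereDomain (Torus.geometry (Fin 3)) n ε with hD
  have hind : D.indicator (tensorPow n (fun y => c * f y)) = fun z => c ^ n * D.indicator (tensorPow n f) z := by
    funext w
    rw [KineticWindowGronwallNegative.tensorPow_const_mul]
    by_cases hw : w ∈ D <;> simp [hw]
  simp only [canonicalPartition, ← hD, hind]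
  exact integral_const_mul _ _

/-- A bounded measurable function on `𝕋³` times a bounded measurable weight is integrable. [folklore] -/
theorem integrable_mul_of_abs_le {f w : T3 → ℝ} (hf : Measurable f) (hw : Measurable w) {Bf Bw : ℝ}
    (hfb : ∀ x, |f x| ≤ Bf) (hwb : ∀ x, |w x| ≤ Bw) : Integrable (fun x => f x * w x) := by
  refine (integrable_const (Bf * Bw)).mono' (hf.mul hw).aestronglyMeasurable (Eventually.of_forall fun x => ?_)
  rw [Real.norm_eq_abs, abs_mul]
  exact mul_le_mul (hfb x) (hwb x) (abs_nonneg _) ((abs_nonneg _).trans (hfb x))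

/-- **The fine-grained entropy of the initial local Gibbs law.** For `σ ≤ 1/2`, continuous positive data profiles,
a static density `ρ_a` (measurable, `0 < c_l ≤ ρ_a ≤ c_u`, `∫ ρ_a = 1`) with `a₀ = e^c ρ_a e^{g(ρ_a)}` where
`g = f_ex(·σ³) + ψ`, and the two static inputs at the activity `ρ_a e^{g(ρ_a)}` — the local density approximation
`(N+1)⁻¹ log Z_N → ∫ ρ_a ψ(ρ_a)` and the law of large numbers of the mean empirical density — the time-zero term
of the bookkeeping identity converges:
`E_λ⟨emp, log prof₀⟩ − (N+1)⁻¹ log Z_N(a₀) → −∫ ρ_a (3/2 log θ₀ − log ρ_a − f_ex(ρ_aσ³)) − 3/2 − (3/2) log 2π`.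
[folklore] -/
theorem tendsto_timeZero_term {σ : ℝ} (hσ2 : σ ≤ 1 / 2) {a₀ θ₀ : T3 → ℝ} {u₀ : T3 → V3}
    (ha : Continuous a₀) (hθ : Continuous θ₀) (hu : Continuous u₀) (ha0 : ∀ x, 0 < a₀ x) (hθ0 : ∀ x, 0 < θ₀ x)
    (Φ : (N : ℕ) → HardSphereFlow (Torus.geometry (Fin 3)) (hsDiameter σ N) (N + 1))
    {ρa : T3 → ℝ} (hρam : Measurable ρa) {cl cu' : ℝ} (hcl : 0 < cl) (hρab : ∀ x, cl ≤ ρa x ∧ ρa x ≤ cu')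
    (hρa1 : ∫ x, ρa x = 1) (g ψ : ℝ → ℝ) (hg : ∀ r, g r = hsExcessFreeEnergy (r * σ ^ 3) + ψ r)
    {Bf Bψ : ℝ} (hfm : Measurable fun x => hsExcessFreeEnergy (ρa x * σ ^ 3))
    (hfb : ∀ x, |hsExcessFreeEnergy (ρa x * σ ^ 3)| ≤ Bf) (hψm : Measurable fun x => ψ (ρa x))
    (hψb : ∀ x, |ψ (ρa x)| ≤ Bψ) {c : ℝ} (hc : ∀ x, a₀ x = Real.exp c * ρa x * Real.exp (g (ρa x)))
    (hZ : Tendsto (fun N : ℕ => ((N : ℝ) + 1)⁻¹ * Real.log (canonicalPartition (Torus.geometry (Fin 3))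
      (hsDiameter σ N) (N + 1) (localGibbsProfile (fun x => ρa x * Real.exp (g (ρa x))) u₀ θ₀))) atTop
      (𝓝 (∫ x, ρa x * ψ (ρa x))))
    (hmean : ∀ χ : T3 → ℝ, Continuous χ → Tendsto (fun N : ℕ => ∫ z, empiricalDensityField z χ
      ∂(localGibbsLaw σ (fun x => ρa x * Real.exp (g (ρa x))) u₀ θ₀ N (Φ N))) atTop (𝓝 (∫ x, χ x * ρa x))) :
    Tendsto (fun N : ℕ => (∫ z, (∫ y, Real.log (localGibbsProfile a₀ u₀ θ₀ y) ∂(empiricalMeasure z))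
        ∂(localGibbsLaw σ a₀ u₀ θ₀ N (Φ N))) -
      ((N : ℝ) + 1)⁻¹ * Real.log (canonicalPartition (Torus.geometry (Fin 3)) (hsDiameter σ N) (N + 1)
        (localGibbsProfile a₀ u₀ θ₀))) atTop
      (𝓝 (-(∫ x, ρa x * (3 / 2 * Real.log (θ₀ x) - Real.log (ρa x) - hsExcessFreeEnergy (ρa x * σ ^ 3))) -
        3 / 2 - 3 / 2 * Real.log (2 * Real.pi))) := by
  set a₁ : T3 → ℝ := fun x => ρa x * Real.exp (g (ρa x)) with ha₁
  have ha01 : a₀ = fun x => Real.exp c * a₁ x := by funext x; rw [hc x, ha₁]; ring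
  have hρa0 : ∀ x, 0 < ρa x := fun x => hcl.trans_le (hρab x).1
  -- the data law IS the law at activity `a₁`, and `Z_N(a₀) = e^{c(N+1)} Z_N(a₁)`
  have hlaw : ∀ N, localGibbsLaw σ a₀ u₀ θ₀ N (Φ N) = localGibbsLaw σ a₁ u₀ θ₀ N (Φ N) := by
    intro N; rw [ha01]; exact localGibbsLaw_const_mul (Φ N) a₁ θ₀ u₀ (Real.exp_pos c)
  have hZ01 : ∀ N, canonicalPartition (Torus.geometry (Fin 3)) (hsDiameter σ N) (N + 1) (localGibbsProfile a₀ u₀ θ₀) =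
      Real.exp c ^ (N + 1) * canonicalPartition (Torus.geometry (Fin 3)) (hsDiameter σ N) (N + 1)
        (localGibbsProfile a₁ u₀ θ₀) := by
    intro N
    rw [ha01, localGibbsProfile_const_mul, canonicalPartition_const_mul]
  have hZ0pos : ∀ N, 0 < canonicalPartition (Torus.geometry (Fin 3)) (hsDiameter σ N) (N + 1)
      (localGibbsProfile a₀ u₀ θ₀) := fun N => canonicalPartition_localGibbs_pos hσ2 N ha hθ hu ha0 hθ0
  have hZ1pos : ∀ N, 0 < canonicalPartition (Torus.geometry (Fin 3)) (hsDiameter σ N) (N + 1)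
      (localGibbsProfile a₁ u₀ θ₀) := by
    intro N
    have h := hZ0pos N
    rw [hZ01 N] at h
    exact pos_of_mul_pos_right h (pow_nonneg (Real.exp_pos c).le _)
  have hlogZ : ∀ N : ℕ, ((N : ℝ) + 1)⁻¹ * Real.log (canonicalPartition (Torus.geometry (Fin 3)) (hsDiameter σ N)
      (N + 1) (localGibbsProfile a₀ u₀ θ₀)) = c + ((N : ℝ) + 1)⁻¹ * Real.log (canonicalPartition
        (Torus.geometry (Fin 3)) (hsDiameter σ N) (N + 1) (localGibbsProfile a₁ u₀ θ₀)) := by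
    intro N
    rw [hZ01 N, Real.log_mul (pow_pos (Real.exp_pos c) _).ne' (hZ1pos N).ne', Real.log_pow, Real.log_exp]
    push_cast
    field_simp
  -- the three one-body terms
  set R : T3 → ℝ := fun x => Real.log ((2 * Real.pi * θ₀ x) ^ (-(Module.finrank ℝ V3 : ℝ) / 2)) with hR
  have hRc : Continuous R := by
    have h1 : Continuous fun x => (2 * Real.pi * θ₀ x) ^ (-(Module.finrank ℝ V3 : ℝ) / 2) :=
      (continuous_const.mul hθ).rpow_const fun x => Or.inl (mul_pos (mul_pos two_pos Real.pi_pos) (hθ0 x)).ne'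
    exact h1.log fun x => (Real.rpow_pos_of_pos (mul_pos (mul_pos two_pos Real.pi_pos) (hθ0 x)) _).ne'
  have hsplit : ∀ N, (∫ z, (∫ y, Real.log (localGibbsProfile a₀ u₀ θ₀ y) ∂(empiricalMeasure z))
      ∂(localGibbsLaw σ a₀ u₀ θ₀ N (Φ N))) =
      (∫ z, empiricalDensityField z (fun x => Real.log (a₀ x)) ∂(localGibbsLaw σ a₁ u₀ θ₀ N (Φ N))) +
        (∫ z, empiricalDensityField z R ∂(localGibbsLaw σ a₁ u₀ θ₀ N (Φ N))) - 3 / 2 := by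
    intro N
    rw [integral_logPair_localGibbsLaw hσ2 ha hθ hu ha0 hθ0 N (Φ N), hlaw N]
  -- the limit of the sequence, before the final algebra
  have hA := hmean _ (ha.log fun x => (ha0 x).ne')
  have hB := hmean _ hRc
  have hlim : Tendsto (fun N : ℕ => (∫ z, (∫ y, Real.log (localGibbsProfile a₀ u₀ θ₀ y) ∂(empiricalMeasure z))
        ∂(localGibbsLaw σ a₀ u₀ θ₀ N (Φ N))) -
      ((N : ℝ) + 1)⁻¹ * Real.log (canonicalPartition (Torus.geometry (Fin 3)) (hsDiameter σ N) (N + 1)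
        (localGibbsProfile a₀ u₀ θ₀))) atTop
      (𝓝 ((∫ x, Real.log (a₀ x) * ρa x) + (∫ x, R x * ρa x) - 3 / 2 - (c + ∫ x, ρa x * ψ (ρa x)))) := by
    have h := ((hA.add hB).sub_const (3 / 2)).sub (tendsto_const_nhds.add hZ : Tendsto (fun N : ℕ => c +
      ((N : ℝ) + 1)⁻¹ * Real.log (canonicalPartition (Torus.geometry (Fin 3)) (hsDiameter σ N) (N + 1)
        (localGibbsProfile a₁ u₀ θ₀))) atTop (𝓝 (c + ∫ x, ρa x * ψ (ρa x))))
    refine h.congr fun N => ?_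
    simp only [hsplit N, hlogZ N]
  -- the final algebra
  have hval : (∫ x, Real.log (a₀ x) * ρa x) + (∫ x, R x * ρa x) - 3 / 2 - (c + ∫ x, ρa x * ψ (ρa x)) =
      -(∫ x, ρa x * (3 / 2 * Real.log (θ₀ x) - Real.log (ρa x) - hsExcessFreeEnergy (ρa x * σ ^ 3))) -
        3 / 2 - 3 / 2 * Real.log (2 * Real.pi) := by
    -- bounds
    have hρabs : ∀ x, |ρa x| ≤ cu' := fun x => by rw [abs_of_pos (hρa0 x)]; exact (hρab x).2
    have hlogρb : ∀ x, |Real.log (ρa x)| ≤ max |Real.log cl| |Real.log cu'| := by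
      intro x
      rw [abs_le]
      constructor
      · have h1 : Real.log cl ≤ Real.log (ρa x) := Real.log_le_log hcl (hρab x).1
        have h2 : -max |Real.log cl| |Real.log cu'| ≤ Real.log cl :=
          (neg_le_neg (le_max_left _ _)).trans (neg_abs_le _)
        linarith
      · have h1 : Real.log (ρa x) ≤ Real.log cu' := Real.log_le_log (hρa0 x) (hρab x).2
        exact h1.trans ((le_abs_self _).trans (le_max_right _ _))
    obtain ⟨Bθ, -, hBθ⟩ := exists_forall_abs_le_of_continuous (hθ.log fun x => (hθ0 x).ne')
    -- integrability of the pieces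
    have hI1 : Integrable (fun x => Real.log (ρa x) * ρa x) :=
      integrable_mul_of_abs_le (Real.measurable_log.comp hρam) hρam hlogρb hρabs
    have hI2 : Integrable (fun x => hsExcessFreeEnergy (ρa x * σ ^ 3) * ρa x) :=
      integrable_mul_of_abs_le hfm hρam hfb hρabs
    have hI3 : Integrable (fun x => ψ (ρa x) * ρa x) := integrable_mul_of_abs_le hψm hρam hψb hρabs
    have hI4 : Integrable (fun x => Real.log (θ₀ x) * ρa x) :=
      integrable_mul_of_abs_le (hθ.log fun x => (hθ0 x).ne').measurable hρam hBθ hρabs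
    have hI0 : Integrable ρa := (integrable_const cu').mono' hρam.aestronglyMeasurable
      (Eventually.of_forall fun x => by rw [Real.norm_eq_abs]; exact hρabs x)
    -- `∫ log a₀ · ρa`
    have hAval : ∫ x, Real.log (a₀ x) * ρa x = c + (∫ x, Real.log (ρa x) * ρa x) +
        (∫ x, hsExcessFreeEnergy (ρa x * σ ^ 3) * ρa x) + ∫ x, ψ (ρa x) * ρa x := by
      have hpt : ∀ x, Real.log (a₀ x) * ρa x = c * ρa x + Real.log (ρa x) * ρa x +
          hsExcessFreeEnergy (ρa x * σ ^ 3) * ρa x + ψ (ρa x) * ρa x := by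
        intro x
        rw [hc x, Real.log_mul (mul_pos (Real.exp_pos c) (hρa0 x)).ne' (Real.exp_pos _).ne',
          Real.log_mul (Real.exp_pos c).ne' (hρa0 x).ne', Real.log_exp, Real.log_exp, hg]
        ring
      simp_rw [hpt]
      have hJ1 : Integrable (fun x => c * ρa x + Real.log (ρa x) * ρa x) := (hI0.const_mul c).add hI1
      have hJ2 : Integrable (fun x => c * ρa x + Real.log (ρa x) * ρa x +
          hsExcessFreeEnergy (ρa x * σ ^ 3) * ρa x) := hJ1.add hI2
      rw [integral_add hJ2 hI3, integral_add hJ1 hI2, integral_add (hI0.const_mul c) hI1, integral_const_mul, hρa1,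
        mul_one]
    -- `∫ R · ρa`
    have hfin : (Module.finrank ℝ V3 : ℝ) = 3 := by
      rw [show Module.finrank ℝ V3 = 3 from finrank_euclideanSpace_fin]; norm_num
    have hRval : ∫ x, R x * ρa x = -(3 / 2) * Real.log (2 * Real.pi) - 3 / 2 * ∫ x, Real.log (θ₀ x) * ρa x := by
      have hpt : ∀ x, R x * ρa x = -(3 / 2) * Real.log (2 * Real.pi) * ρa x - 3 / 2 * (Real.log (θ₀ x) * ρa x) := by
        intro x
        simp only [hR]
        rw [Real.log_rpow (mul_pos (mul_pos two_pos Real.pi_pos) (hθ0 x)), hfin,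
          Real.log_mul (mul_pos two_pos Real.pi_pos).ne' (hθ0 x).ne']
        ring
      simp_rw [hpt]
      rw [integral_sub (hI0.const_mul _) (hI4.const_mul _), integral_const_mul, integral_const_mul, hρa1, mul_one]
    -- the entropy integral
    have hSval : ∫ x, ρa x * (3 / 2 * Real.log (θ₀ x) - Real.log (ρa x) - hsExcessFreeEnergy (ρa x * σ ^ 3)) =
        3 / 2 * (∫ x, Real.log (θ₀ x) * ρa x) - (∫ x, Real.log (ρa x) * ρa x) -
          ∫ x, hsExcessFreeEnergy (ρa x * σ ^ 3) * ρa x := by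
      have hpt : ∀ x, ρa x * (3 / 2 * Real.log (θ₀ x) - Real.log (ρa x) - hsExcessFreeEnergy (ρa x * σ ^ 3)) =
          3 / 2 * (Real.log (θ₀ x) * ρa x) - Real.log (ρa x) * ρa x - hsExcessFreeEnergy (ρa x * σ ^ 3) * ρa x := by
        intro x; ring
      simp_rw [hpt]
      have hJ3 : Integrable (fun x => 3 / 2 * (Real.log (θ₀ x) * ρa x) - Real.log (ρa x) * ρa x) :=
        (hI4.const_mul _).sub hI1
      rw [integral_sub hJ3 hI2, integral_sub (hI4.const_mul _) hI1, integral_const_mul]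
    have hψcomm : ∫ x, ρa x * ψ (ρa x) = ∫ x, ψ (ρa x) * ρa x := by
      refine integral_congr_ae (Eventually.of_forall fun x => ?_)
      simp only [mul_comm]
    rw [hAval, hRval, hSval, hψcomm]
    ring
  rw [hval] at hlim
  exact hlim

end Summit.AtomisticToContinuum.HydrodynamicLimit.Theorems.JaynesSqueezeSqueeze

end
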